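import Summits.BirchSwinnertonDyer.BirchSwinnertonDyer.Theses.PrintCf2RubinValueTwo
import Summits.BirchSwinnertonDyer.BirchSwinnertonDyer.Theorems.PrintCf2SplitBadTwoDefectKeyAtTwo
import HarnessLib

/-!
# Crux `PrintCf2RubinValueTwo.RubinValueFormulaAtTwo` (stmt-BirchSwinnertonDyer-23721, S2′ of road α):
# THE VALUE-FORMULA CRUX FOLLOWS FROM THE DEFECT KEY AND THE THREE ALGEBRAIC CRUXES OF ROUTE C

Cell `bsd-print-cf2`, LEAD seat `cruxlead-23721` g2 (prover-cruxlead-stmt-BirchSwinnertonDyer-23721-g2-0), line `value-transport`;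
`--supports stmt-BirchSwinnertonDyer-23721`. THEOREMS ONLY (no `def`, no named fact, no `sorry`). HONEST FRAMING: nothing here
closes the crux; every research statement is an explicit binder; BSD is not proved by any of this; no summit statement is proved
by this seat.

WHAT. Route C decomposes PrintCf2's split-bad class crux `SplitBadTwoRankOneOfFacts` (stmt-20368) into the two-variable main
conjecture S3a (`TwoVariableMainConjAtSplitTwo`, 23720), Rubin's `2`-adic VALUE FORMULA S2′ (`RubinValueFormulaAtTwo`, 23721 — the
ANALYTIC law: the value of the `θK⁻¹`-branch measure at the `(ψ∘c)⁻¹`-point has norm `2^{−(2·(v₂ #Ш_an + v₂ ∏c − 2v₂ #tors + 2ℓ) + e_A)/2}`),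
the restricted main conjecture with its value S3b′ (`RestrictedMainConjWithValueAtTwo`, 23722 — the ALGEBRAIC law: the same value
has norm `2^{−(2n + e_M)/2}` for the characteristic valuation `n` of a restricted dual datum) and the control law S3c
(`RestrictedSelmerControlAtTwo`, 23723, CLOSED — `n = v₂ #Ш[2^∞] + v₂ ∏c − 2 v₂ #tors + 2ℓ + e_C`). The LEAD kernel
(`RubinValueTwo.defectKey_of_laws`, `…SplitBadOfIngredients.defectKey_of_items`) reads S2′ ∧ S3b′ ∧ S3c as the DEFECT KEY

  (DK)  `v₂ #Ш_an(W) = v₂ #Ш(W)[2^∞] + e([d]₂)` for ONE function `e` of the `2`-adic square class, on every member of the class,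

and the anchors pin `e = 0`. THIS FILE proves the CONVERSE composition:

* `rubinValueFormulaAtTwo_of_defectKey` — (DK) ∧ 23720 ∧ 23722 ∧ 23723 ⟹ 23721 BY NAME, with `e_A := 2e_C + e_M − 2e`: on an S2′
  frame the algebraic law pins `‖val‖ = 2^{−(2n + e_M)/2}`, so any `m` with `‖val‖ = 2^{−m/2}` IS `2n + e_M`; S3c evaluates `n`, and
  (DK) trades `v₂ #Ш[2^∞]` for `v₂ #Ш_an`. Pure logic over the item texts (the S2′ and S3b′ frames are the same v10.3 frame).
* `rubinValueFormulaAtTwo_of_splitBadTwoRankOneOfFacts` — hence the class theorem itself (with its published bundle `𝔅_split`,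
  which gives (DK) with `e = 0`: `RubinValueTwo.defectKey_of_splitBadTwoRankOneOfFacts`) and the algebraic cruxes imply S2′.

CONSEQUENCE (for the planner / refuters, recorded in the crux's census): modulo the algebraic cruxes 23720 ∧ 23722 ∧ 23723 (and the
landed frame supply / anchors / prints on the other side), item 23721 is EQUIVALENT to the defect key (DK), i.e. to the parent class
crux 20368: S2′ is not a proper sub-statement of the class theorem but its analytic half, and it is refutable only by refuting
`BSD₂`-defect uniformity on a `2`-adic square class or one of the algebraic laws. The beyond-print content of S2′ is therefore exactly
a `2`-adic Gross–Zagier-type bridge (Rubin 1992 §8/§10 via Perrin-Riou's `𝔭`-adic heights, or Bertolini–Darmon–Prasanna / a `p`-adic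
Waldspurger formula, at the additive split prime `2`), none of which is in print for `p ∣ N`.

References: [cite: Rubin1992, Thm. 8.2, Cor. 10.2–10.3 (p. 339, 344; shape)]; [cite: Agboola2007, Thm. 2]; [cite: GrossZagier1986, Thm. I.(7.3)].
-/

set_option autoImplicit false
set_option linter.dupNamespace false

noncomputable section

open scoped Classical
open NumberField IsDedekindDomain Field WeierstrassCurve
open Literature.NumberTheory.GaloisRepresentations Literature.NumberTheory.EllipticCurves
open Literature.NumberTheory.EllipticCurves.Rank1Residual
open Literature.NumberTheory.EllipticCurves.DeShalit1987
open Summit.BirchSwinnertonDyer.BirchSwinnertonDyer.Theses.PrintCf2RubinValueTwo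

namespace Summit.BirchSwinnertonDyer.BirchSwinnertonDyer.Theorems.PrintCf2.RubinValueFormulaOfDefectKey

/-- **(DK) ∧ S3a ∧ S3b′ ∧ S3c ⟹ S2′ (item 23721 BY NAME)**, with `e_A := 2·e_C + e_M − 2·e`. Given an S2′ frame (member `W ≅ cm7^{(d)}`
of analytic rank one, `K`, `v ≠ v̄` over `2`, `ι`, `c`, `ψ`, a generator pair, `θK`, `ρ`, `r`, `Sθ`, periods, a solution `G₂` of
`IsKatzMeasure₂ … θK⁻¹ …`, a generator datum `(P, c₀, ℓ)`): S3b′ (fed S3a) supplies a pinned restricted dual datum `D` with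
`D.HasCharValuationAt n` and `‖val‖ = 2^{−(2n + e_M)/2}` for EVERY value `val` of `G₂` at the point; so a displayed `m` with
`‖val‖ = 2^{−m/2}` equals `2n + e_M` (`Real.rpow_right_inj`); S3c gives `n = v₂ #Ш[2^∞] + v₂ ∏c − 2 v₂ #tors + 2ℓ + e_C`; (DK) gives
`q = #Ш_an ∈ ℚ` with `v₂ q = v₂ #Ш[2^∞] + e`. [cite: Rubin1992, Cor. 10.2–10.3 (p. 344; shape)] [cite: Agboola2007, Thm. 2] -/
theorem rubinValueFormulaAtTwo_of_defectKey
    (hDK : GrossZagier1986_thm_I_7_3 → rank_eq_analyticRank_of_analyticRank_le_one →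
      ∃ e : ℤ → ℤ → ℤ,
      ∀ (d : ℤ), d ≠ 0 → Squarefree d → d % 4 ≠ 1 →
      ∀ (W : WeierstrassCurve ℚ) [W.IsElliptic] [W.IsGloballyMinimal] (C : VariableChange ℚ),
        C • W = cm7.quadraticTwist (d : ℚ) → W.analyticRank = 1 →
      ∃ q : ℚ, shaAn W = (q : ℂ) ∧
        padicValRat 2 q = (padicValNat 2 (Nat.card (AddCommGroup.primaryComponent W.sha 2)) : ℤ)
          + e (d % 2) ((d / (2 - d % 2)) % 8))
    (h3a : TwoVariableMainConjAtSplitTwo) (h3b : RestrictedMainConjWithValueAtTwo) (h3c : RestrictedSelmerControlAtTwo) :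
    RubinValueFormulaAtTwo := by
  intro hGZ hGZK
  obtain ⟨e, he⟩ := hDK hGZ hGZK
  obtain ⟨eM, hM⟩ := h3b h3a
  obtain ⟨eC, hC⟩ := h3c
  refine ⟨fun k₁ k₂ ↦ 2 * eC k₁ k₂ + eM k₁ k₂ - 2 * e k₁ k₂, ?_⟩
  intro d hd0 hsq hd4 W _ _ C hCW hr K _ _ hK v vbar hv hvbar hne ι hι c hc ψ hψ hL κ₁ κ₂ γ₁ γ₂ hpair θK ρ r hθK hρr hrpair hρ
    Sθ hvS hvbarS hSram hSunr Ω δ Ωp G₂ hΩ hδ hG₂ P c₀ ℓ hP hgen hc₀ hker hlog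
  obtain ⟨q, hq, hvq⟩ := he d hd0 hsq hd4 W C hCW hr
  refine ⟨q, hq, fun val m hval hnorm ↦ ?_⟩
  obtain ⟨π, hπ, r₀, hr₀, hpin, κ', hκ', γ', hγ', D, n, hDf, hDn, hvalM⟩ :=
    hM d hd0 hsq hd4 W C hCW hr K hK v vbar hv hvbar hne ι hι c hc ψ hψ hL κ₁ κ₂ γ₁ γ₂ hpair θK ρ r hθK hρr hrpair hρ
      Sθ hvS hvbarS hSram hSunr Ω δ Ωp G₂ hΩ hδ hG₂ P c₀ ℓ hP hgen hc₀ hker hlog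
  have hn := hC d hd0 hsq hd4 W C hCW hr K hK v vbar hv hvbar hne π hπ r₀ hr₀ hpin κ' hκ' γ' hγ' D n hDf hDn
    P c₀ ℓ hP hgen hc₀ hker hlog
  have h1 := hvalM val hval
  rw [hnorm] at h1
  have hexp := (Real.rpow_right_inj (by norm_num : (0 : ℝ) < 2) (by norm_num : (2 : ℝ) ≠ 1)).mp h1
  have hm : (m : ℝ) = ((2 * (n : ℤ) + eM (d % 2) ((d / (2 - d % 2)) % 8) : ℤ) : ℝ) := by linarith
  have hm' : m = 2 * (n : ℤ) + eM (d % 2) ((d / (2 - d % 2)) % 8) := by exact_mod_cast hm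
  rw [hm', hn, hvq]
  ring

/-- **The class theorem implies its value-formula crux (modulo the algebraic cruxes).** PrintCf2's split-bad class theorem
`SplitBadTwoRankOneOfFacts` with its published bundle `𝔅_split` gives (DK) with `e = 0`
(`RubinValueTwo.defectKey_of_splitBadTwoRankOneOfFacts`, LEAD g9), hence S2′ by `rubinValueFormulaAtTwo_of_defectKey`. Together with
the LEAD kernel in the other direction (S2′ ∧ S3a ∧ S3b′ ∧ S3c ∧ frame supply ∧ anchors ∧ prints ⟹ the class theorem), item 23721
is the analytic HALF of the class crux, equivalent to it modulo the algebraic laws — not a smaller statement.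
[cite: Rubin1992, Cor. 10.2–10.3 (p. 344; shape)] [cite: Miller2011LMS, Def. 1.1] -/
theorem rubinValueFormulaAtTwo_of_splitBadTwoRankOneOfFacts
    (h : Summit.BirchSwinnertonDyer.BirchSwinnertonDyer.Theses.PrintCf2.SplitBadTwoRankOneOfFacts)
    (hB : rank_eq_analyticRank_of_analyticRank_le_one ∧ hasEntireLFunction_rat ∧
      bsdRHS_eq_of_isIsogenous ∧ bsdTriple_of_hasCM_of_L_one_ne_zero ∧ KrizLi2019.thm112_bsdTwo_twist)
    (h3a : TwoVariableMainConjAtSplitTwo) (h3b : RestrictedMainConjWithValueAtTwo) (h3c : RestrictedSelmerControlAtTwo) :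
    RubinValueFormulaAtTwo :=
  rubinValueFormulaAtTwo_of_defectKey
    (fun _ _ ↦ Summit.BirchSwinnertonDyer.BirchSwinnertonDyer.Theorems.PrintCf2.RubinValueTwo.defectKey_of_splitBadTwoRankOneOfFacts h hB)
    h3a h3b h3c

end Summit.BirchSwinnertonDyer.BirchSwinnertonDyer.Theorems.PrintCf2.RubinValueFormulaOfDefectKey

end
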